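import Summits.BirchSwinnertonDyer.Rank1Residual.F1Sign2.TwistLatticeAtTwo
import Literature.NumberTheory.EllipticCurves.ReducibleModThreeFrobeniusTrace
import HarnessLib

/-!
# ES-33 kernel — -es g24's glue theorems (crux workfile `TwistLatticeES33.lean` 07ba41998bc5acbc, VERBATIM) + REF1-AUDIT §256's probes for `F1Sign2/TwistLatticeAtTwo.lean`
# (typer -ty g20)

CONTENT (all PROVED, no `sorry`, no new `def`): -es glue `even_of_twistLattice` (ES-33A ⟹ ES-33A₁), `twistLattice_dvd_of_deep` (A♯ refines A on its locus),
`twoAdicTwistRank_le_extra` (ES-33E ⟹ ES-33B pointwise in the exponent), `sliceTrivial_of_floor` (ES-33B ⟹ the slice row's conclusion `#Sel₂ ≤ 2`), `twistLattice_of`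
(ES-33A⁰ ∧ ES-33A¹ ⟹ ES-33A); REF1 §256 probes (`REF1-data/b256/Probe256.lean` 528a16f1f219529d) P2–P5 as named theorems (`decide` / `simp`); the typer's
`squareLevelTwistRank_oneSevenSix` (`176 = 2⁴·11 ↦ 1`) and `squareLevelTwistRank_ninetyTwo` (`92 = 2²·23 ↦ 0`) re-prove two of the workfile's `native_decide` sanity values
by rewriting `Nat.primeFactors` of the explicit factorisation (no `native_decide` in the tree port).  The parent opens `Classical AddSubgroup` at file level — mirrored here
(lesson of p741343).  BSD is not proved by this; 23715 is not closed by this.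
v2 ADDENDUM (typer -ty g21): + `dvd_congruenceNumber_of_twist` (ES-33F glue: under `CongruenceNumberTwistInvariant` every divisibility of the congruence number transports along a
conductor-preserving twist; -es crux workfile v2 c5c258e7def98a9e, VERBATIM; REF1 §288 K288.1 `dvd_iff_of_twist`).
v3 ADDENDUM (typer -ty g21): + -es g24's addendum-3/4 glue (crux workfile v4 8667786b017bfee1, VERBATIM): `twoAdicDeep_of_resolvent` ((R) ⟹ (A♯₂)), `deepTwist_of_resolvent`
((R) ⟹ ES-33A♯), `jacobiSym_neg_three_of_mod_three_eq_one`, `threeIsogenyTwist_of_oddStabiliser` ((Gℓ) ∧ (T) ⟹ (G₃)) — the workfile's fourth lemma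
`jacobiSym_neg_three_of_mod_three_eq_two` is NOT re-declared (gate `dedup.landed`, p757955: it is `Summit.BirchSwinnertonDyer.BirchSwinnertonDyer.Theorems.SylvesterCorner.jacobiSym_neg_three_eq_neg_one`
of `Theorems/BiquadraticEisensteinDescentHeegnerTwistCouplingInSupplySylvesterCornerLucasBridge.lean`; unused by the glue); + REF1
§301's Probe301 sanity `example`s (`REF1-data/b301/block301.lean`; the three `native_decide` level checks omitted — no `native_decide` in the tree port).
v4 ADDENDUM (typer -ty g22): **(T) DISCHARGED** — the parent's print-fact shape `ModThreeReducibleTraceVanishing` (a rational 3-isogeny forces `3 ∣ a_p` at every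
good `p ≡ 2 (mod 3)`) is now a THEOREM of the tree: `Literature/NumberTheory/EllipticCurves/ReducibleModThreeFrobeniusTrace.lean` (p759212; Mazur 1978 §5 isogeny
character + §6 Prop. 6.3 (1) `r² − a_ℓ r + ℓ ≡ 0 (mod N)` assembled from the tree's PROVED `Mazur1978.isogenyCharacter_sq_sub_frobeniusTrace_mul_add_eq_zero`, with
`r = ±1` in `𝔽₃^×`; REF1 §301 R301b served).  Hence `modThreeReducibleTraceVanishing_holds` and `threeIsogenyTwist_of_oddStabiliser'`: (Gℓ) ALONE ⟹ (G₃).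
v5 ADDENDUM (typer -ty g22): + -es g24's addendum-5 glue (crux workfile 41d37d025705b01d, VERBATIM): `sharp_imp_resolvent_minimal` ((R♯) ⟹ (R) on globally minimal models).
v6 ADDENDUM (typer -ty g22): + -es g25's glue `nonsplitCartanFourSharp_of_nonsplit` (ES-33I ⟹ ES-33I♯; crux workfile v6 56e746de48b91890, VERBATIM).
-/

open scoped Classical AddSubgroup

noncomputable section

set_option linter.dupNamespace false
set_option autoImplicit false

namespace Summit.BirchSwinnertonDyer.BirchSwinnertonDyer.Theorems.RankOneAtTwoTwistLattice.Kernel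

open Literature.NumberTheory.EllipticCurves Literature.NumberTheory.EllipticCurves.ModularForms WeierstrassCurve

/-! ### -es g24 glue theorems (crux workfile, VERBATIM) -/

/-- The parity case follows from the lattice statement. -/
theorem even_of_twistLattice (h : TwistLatticeDividesCongruenceNumber) : EvenCongruenceNumberAtSquareLevel := by
  intro W _ _ D hcm hpos
  exact (dvd_pow_self 2 (Nat.pos_iff_ne_zero.mp hpos)).trans (h W D hcm)

/-- ES-33A♯ refines ES-33A on its locus (bookkeeping). -/
theorem twistLattice_dvd_of_deep {W : WeierstrassCurve ℚ} [W.IsElliptic] [NeZero (W.conductorNorm ℤ)]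
    (D : ModularParametrizationData W (W.conductorNorm ℤ))
    (h : 2 ^ (squareLevelTwistRank (W.conductorNorm ℤ) + 1) ∣ congruenceNumber D.f) :
    2 ^ squareLevelTwistRank (W.conductorNorm ℤ) ∣ congruenceNumber D.f :=
  (pow_dvd_pow 2 (Nat.le_succ _)).trans h

/-- ES-33E implies ES-33B's inequality pointwise in the exponent: `a₂(v) = [v ≥ 4] + [v ≥ 6] ≤ [v ≥ 3](v − 1)` (bookkeeping). -/
theorem twoAdicTwistRank_le_extra (v : ℕ) : (if 4 ≤ v then 1 else 0) + (if 6 ≤ v then 1 else 0) ≤ conductorFloorExtra v := by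
  unfold conductorFloorExtra
  split_ifs <;> omega

/-- Elementary glue: the congruence-number floor implies the slice statement (arithmetic on exponents). -/
theorem sliceTrivial_of_floor (h : CongruenceNumberSelmerALFloor)
    (W : WeierstrassCurve ℚ) [W.IsElliptic] [W.IsGloballyMinimal] [NeZero (W.conductorNorm ℤ)]
    (h2 : W.HasSurjectiveModNGaloisRep ((2 : ℕ) : ℤ))
    (D : ModularParametrizationData W (W.conductorNorm ℤ))
    (hopt : ∀ (W'' : WeierstrassCurve ℚ) [W''.IsElliptic] (D'' : ModularParametrizationData W'' (W.conductorNorm ℤ)),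
        D''.f = D.f → D.modularDegree ≤ D''.modularDegree)
    (hmin : padicValNat 2 (congruenceNumber D.f) = primeCount (W.conductorNorm ℤ) + twoAdicTwistRank (W.conductorNorm ℤ)) :
    Nat.card (W.selmerGroup 2) ≤ 2 := by
  have := h W D hopt h2
  rw [hmin] at this
  have hp : 0 < 2 ^ (primeCount (W.conductorNorm ℤ) + twoAdicTwistRank (W.conductorNorm ℤ)) := by positivity
  nlinarith

/-- Kernel glue: the abstract lattice lemma and the printed existence of admissible twists give ES-33A. -/
theorem twistLattice_of (hL : SignedTwistLatticeLemma) (hT : AdmissibleTwistsExist) :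
    TwistLatticeDividesCongruenceNumber := by
  intro W _ _ D hcm
  obtain ⟨ε, g, h0, horth, hcoef⟩ := hT W D hcm
  exact hL _ _ D.f ε g (Literature.NumberTheory.EllipticCurves.ModularForms.IsNewform0.ne_zero D.isNewformOf.1)
    D.f_mem_integralCuspForms0 h0 horth hcoef

/-! ### REF1-AUDIT §256 probes (`REF1-data/b256/Probe256.lean` 528a16f1f219529d, namespace `REF1_256`; the `decide` ones VERBATIM as named theorems — P1's two
`native_decide` level evaluations are replaced by the typer's kernel-checked `squareLevelTwistRank_oneSevenSix` / `squareLevelTwistRank_ninetyTwo` below) -/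

/-- REF1 §256 P2: `primeStar` residues used by the clause at 2: `(-3) % 8 = 5` (1323: `p = 3`, `p* = −3` is NOT `≡ 1 (mod 8)` — the clause bites), `(-7) % 8 = 1`. -/
theorem primeStar_three_mod_eight : primeStar 3 % 8 = 5 := by decide

/-- REF1 §256 P2 (second value): `7* = −7 ≡ 1 (mod 8)`. -/
theorem primeStar_seven_mod_eight : primeStar 7 % 8 = 1 := by decide

/-- REF1 §256 P2 (third value): `5* = 5` (`5 ≡ 1 (mod 4)`). -/
theorem primeStar_five : primeStar 5 = 5 := by decide

/-- REF1 §256 P3: `conductorFloorExtra` table `F(v) = 0,0,0,2,3,4,5,6,7` for `v = 0..8` (ES-33E's floors; `F(7) = 6`, `F(8) = 7` are -es's predictions). -/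
theorem conductorFloorExtra_table : (List.range 9).map conductorFloorExtra = [0, 0, 0, 2, 3, 4, 5, 6, 7] := by decide

/-- REF1 §256 P4: the `k = 0` instance of the abstract lattice lemma is trivial bookkeeping (`2^0 ∣ r`). -/
theorem two_pow_zero_dvd (r : ℕ) : 2 ^ 0 ∣ r := by simp

/-- REF1 §256 P5: ES-33E ⟹ ES-33B's exponent inequality at every `v` (the file's `twoAdicTwistRank_le_extra`, re-checked numerically for `v ≤ 12`). -/
theorem twoAdicTwistRank_le_extra_table :
    ∀ v ∈ List.range 13, (if 4 ≤ v then 1 else 0) + (if 6 ≤ v then 1 else 0) ≤ conductorFloorExtra v := by decide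

/-! ### -es g24's sanity values of the counting functions, kernel-checked (the workfile's five `native_decide` examples are not ported; two of them are re-proved
here by rewriting `Nat.primeFactors` of an explicit factorisation) -/

/-- `176 = 2⁴·11` (11a1 ⊗ χ₋₄): one admissible 2-adic twist, no odd square. -/
theorem squareLevelTwistRank_oneSevenSix : squareLevelTwistRank 176 = 1 := by
  rw [squareLevelTwistRank, oddSquareCount, twoAdicTwistRank, show (176 : ℕ) = 2 ^ 4 * 11 by norm_num,
    Nat.primeFactors_mul (by norm_num) (by norm_num), Nat.primeFactors_prime_pow (by norm_num) (by norm_num),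
    Nat.Prime.primeFactors (by norm_num)]
  decide

/-- `92 = 2²·23` (a dip level): no square-level twist at all. -/
theorem squareLevelTwistRank_ninetyTwo : squareLevelTwistRank 92 = 0 := by
  rw [squareLevelTwistRank, oddSquareCount, twoAdicTwistRank, show (92 : ℕ) = 2 ^ 2 * 23 by norm_num,
    Nat.primeFactors_mul (by norm_num) (by norm_num), Nat.primeFactors_prime_pow (by norm_num) (by norm_num),
    Nat.Prime.primeFactors (by norm_num)]
  decide

/-- (-es crux workfile v2 c5c258e7def98a9e, VERBATIM.) Kernel glue: under ES-33F every `2`-power divisibility of the congruence number transports along a conductor-preserving twist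
(this is how the twist lattice of ES-33A moves inside a twist orbit). -/
theorem dvd_congruenceNumber_of_twist (hF : CongruenceNumberTwistInvariant)
    {W : WeierstrassCurve ℚ} [W.IsElliptic] {d : ℚ} [(W.quadraticTwist d).IsElliptic]
    [NeZero (W.conductorNorm ℤ)] [NeZero ((W.quadraticTwist d).conductorNorm ℤ)]
    (D : ModularParametrizationData W (W.conductorNorm ℤ))
    (D' : ModularParametrizationData (W.quadraticTwist d) ((W.quadraticTwist d).conductorNorm ℤ))
    (hN : (W.quadraticTwist d).conductorNorm ℤ = W.conductorNorm ℤ) {k : ℕ} (hk : k ∣ congruenceNumber D.f) :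
    k ∣ congruenceNumber D'.f := by
  rw [hF W d D D' hN]; exact hk

/-- (-es crux workfile v4 8667786b017bfee1, VERBATIM.) Kernel glue: the 2-adic rows are the cases `m = −1, 2, −2` of the general resolvent statement. -/
theorem twoAdicDeep_of_resolvent (h : ResolventTwistDividesCongruenceNumber) :
    TwoAdicDeepTwistDividesCongruenceNumber := by
  intro W _ _ D m hcm hm hsq h4 h6 hsplit
  have four_dvd : 2 ^ 4 ∣ W.conductorNorm ℤ → 4 ∣ W.conductorNorm ℤ :=
    fun h16 => dvd_trans (by norm_num) h16
  rcases hm with rfl | rfl | rfl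
  · refine h W D (-1) hcm isUnit_one.neg.squarefree (by decide) hsq ?_ (fun _ => h4 rfl) (fun h2 => by omega) hsplit
      (fun hn => absurd (four_dvd (h4 rfl)) hn)
    intro p hp _ hd
    exact absurd (Nat.dvd_one.mp (by exact_mod_cast (dvd_neg.mp hd))) hp.one_lt.ne'
  · refine h W D 2 hcm Int.prime_two.squarefree (by decide) hsq ?_ (fun h3 => by omega) (fun _ => h6 (Or.inl rfl)) hsplit
      (fun hn => absurd (four_dvd (dvd_trans (pow_dvd_pow 2 (by norm_num)) (h6 (Or.inl rfl)))) hn)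
    intro p hp hp2 hd
    have hd' : p ∣ 2 := by exact_mod_cast hd
    rcases (Nat.dvd_prime Nat.prime_two).mp hd' with h1 | h2
    · exact absurd h1 hp.one_lt.ne'
    · exact absurd h2 hp2
  · refine h W D (-2) hcm Int.prime_two.neg.squarefree (by decide) hsq ?_ (fun h3 => by omega) (fun _ => h6 (Or.inr rfl)) hsplit
      (fun hn => absurd (four_dvd (dvd_trans (pow_dvd_pow 2 (by norm_num)) (h6 (Or.inr rfl)))) hn)
    intro p hp hp2 hd
    have hd' : p ∣ 2 := by exact_mod_cast (dvd_neg.mp hd)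
    rcases (Nat.dvd_prime Nat.prime_two).mp hd' with h1 | h2
    · exact absurd h1 hp.one_lt.ne'
    · exact absurd h2 hp2

/-- (-es crux workfile v4 8667786b017bfee1, VERBATIM.) Kernel glue: the typed ES-33A♯ (odd prime resolvent `p*`) is the case `m = p*` of the general statement. -/
theorem deepTwist_of_resolvent (h : ResolventTwistDividesCongruenceNumber) : DeepTwistDividesCongruenceNumber := by
  intro W _ _ D p hcm hp hp2 hsqN hsq h8 hsplit
  have hodd : p % 2 = 1 := Nat.odd_iff.mp (hp.odd_of_ne_two hp2)
  have hpZ : Prime (p : ℤ) := Nat.prime_iff_prime_int.mp hp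
  have hsf : Squarefree (primeStar p) := by
    unfold primeStar; split_ifs
    · exact hpZ.squarefree
    · exact hpZ.neg.squarefree
  have hne : primeStar p ≠ 1 := by
    have := hp.two_le; unfold primeStar; split_ifs <;> omega
  have hmod4 : primeStar p % 4 = 3 → 2 ^ 4 ∣ W.conductorNorm ℤ := by
    intro h3; exfalso; unfold primeStar at h3; split_ifs at h3 <;> omega
  have heven : 2 ∣ primeStar p → 2 ^ 6 ∣ W.conductorNorm ℤ := by
    intro h2; exfalso; unfold primeStar at h2; split_ifs at h2 <;> omega
  refine h W D (primeStar p) hcm hsf hne hsq ?_ hmod4 heven hsplit h8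
  intro p' hp' _ hd
  have hd' : p' ∣ p := by
    unfold primeStar at hd; split_ifs at hd
    · exact_mod_cast hd
    · exact_mod_cast (dvd_neg.mp hd)
  rcases (Nat.dvd_prime hp).mp hd' with h1 | h1
  · exact absurd h1 hp'.one_lt.ne'
  · subst h1; exact hsqN

/-- (-es crux workfile v4 8667786b017bfee1, VERBATIM.) `(−3/q) = +1` for odd `q ≡ 1 (mod 3)` (periodicity of the Jacobi symbol modulo `12`). -/
theorem jacobiSym_neg_three_of_mod_three_eq_one {q : ℕ} (hq : Odd q) (h1 : q % 3 = 1) : jacobiSym (-3) q = 1 := by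
  rw [jacobiSym.mod_right (-3) hq]
  have h12 : q % (4 * (-3 : ℤ).natAbs) = q % 12 := by norm_num
  rw [h12]
  have : q % 12 = 1 ∨ q % 12 = 7 := by obtain ⟨k, rfl⟩ := hq; omega
  rcases this with h | h <;> rw [h] <;> norm_num

/-- (-es crux workfile v4 8667786b017bfee1, VERBATIM.) Kernel glue: ES-33G₃ is the case `ℓ = 3` of ES-33Gℓ, given the trace fact (and `(−3/p) = −1 ↔ p ≡ 2 (mod 3)` for primes `p > 3`). -/
theorem threeIsogenyTwist_of_oddStabiliser (h : OddTwistStabiliserDividesCongruenceNumber)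
    (ht : ModThreeReducibleTraceVanishing) : ThreeIsogenyTwistDividesCongruenceNumber := by
  intro W _ _ _ D hcm hred h9 hsplit
  have hps : primeStar 3 = -3 := by unfold primeStar; norm_num
  have h3N : 3 ∣ W.conductorNorm ℤ := dvd_trans (dvd_pow_self 3 (by norm_num)) h9
  have h2 : 2 ∣ W.conductorNorm ℤ → ¬ 4 ∣ W.conductorNorm ℤ → (primeStar 3 % 8 = 1 ∨ primeStar 3 % 8 = 7) := by
    intro h2 h4
    have h22 : ¬ 2 ^ 2 ∣ W.conductorNorm ℤ := by simpa using h4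
    have := hsplit 2 Nat.prime_two h2 h22
    omega
  refine h W D 3 Nat.prime_three (by norm_num) hcm h9 ?_ ?_ ?_ h2
  · intro p hp hp2 hgood hj
    rw [hps] at hj
    have hp3 : p ≠ 3 := by rintro rfl; exact hgood h3N
    have hodd : Odd p := hp.odd_of_ne_two hp2
    have hmod : p % 3 = 2 := by
      have h0 : p % 3 ≠ 0 := by
        intro h0
        have h3p : 3 ∣ p := Nat.dvd_of_mod_eq_zero h0
        rcases (Nat.dvd_prime hp).mp h3p with h | h
        · norm_num at h
        · exact hp3 h.symm
      by_contra hne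
      have h1 : p % 3 = 1 := by omega
      rw [jacobiSym_neg_three_of_mod_three_eq_one hodd h1] at hj
      norm_num at hj
    exact ht W hred p hp hgood hmod
  · intro h2good _
    exact ht W hred 2 Nat.prime_two h2good (by norm_num)
  · intro q hq hq2 hqN hqsq
    rw [hps]
    exact jacobiSym_neg_three_of_mod_three_eq_one (hq.odd_of_ne_two hq2) (hsplit q hq hqN hqsq)

/-! ### REF1-AUDIT §301 probe block (`REF1-data/b301/block301.lean`, examples VERBATIM minus the three `native_decide` level checks and the one example using the dedup-skipped Jacobi lemma; typer -ty g21) -/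
section REF1_301

-- (1) the five new rows are Props and the three glue theorems have the advertised directions
example : Prop := ResolventTwistDividesCongruenceNumber
example : Prop := TwoAdicDeepTwistDividesCongruenceNumber
example : Prop := OddTwistStabiliserDividesCongruenceNumber
example : Prop := ModThreeReducibleTraceVanishing
example : Prop := ThreeIsogenyTwistDividesCongruenceNumber
example (h : ResolventTwistDividesCongruenceNumber) :
    DeepTwistDividesCongruenceNumber ∧ TwoAdicDeepTwistDividesCongruenceNumber :=
  ⟨deepTwist_of_resolvent h, twoAdicDeep_of_resolvent h⟩
example : OddTwistStabiliserDividesCongruenceNumber → ModThreeReducibleTraceVanishing →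
    ThreeIsogenyTwistDividesCongruenceNumber := threeIsogenyTwist_of_oddStabiliser

-- (2) Int.emod semantics of the clauses for NEGATIVE resolvent discriminants (Lean `%` on ℤ = emod, non-negative):
--     m = −1 triggers the `m % 4 = 3 → 16 ∣ N` clause (cond χ₋₄ = 4); m = −3 does not (odd conductor 3);
--     m = −7 meets the clause at 2 (`m % 8 = 1`: 2 splits in ℚ(√−7)); m = −3 does not ((−3) % 8 = 5: 2 inert).
example : (-1 : ℤ) % 4 = 3 := by decide
example : (-3 : ℤ) % 4 = 1 := by decide
example : (-7 : ℤ) % 8 = 1 := by decide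
example : (-3 : ℤ) % 8 = 5 := by decide
example : (-2 : ℤ) % 4 = 2 := by decide

-- (3) `primeStar ℓ ≡ 1 (mod 4)` for odd ℓ, so in ES-33Gℓ the disjunct `primeStar ℓ % 8 = 7` is dead (cosmetic R301a):
example (ℓ : ℕ) (hℓ : ℓ % 2 = 1) : primeStar ℓ % 4 = 1 := by
  unfold primeStar; split_ifs <;> omega
example (ℓ : ℕ) (hℓ : ℓ % 2 = 1) : primeStar ℓ % 8 ≠ 7 := by
  unfold primeStar; split_ifs <;> omega
example : primeStar 3 = -3 := by unfold primeStar; norm_num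
example : primeStar 5 = 5 := by unfold primeStar; norm_num
example : primeStar 7 = -7 := by unfold primeStar; norm_num

-- (4) the Jacobi lemmas at small arguments (7 ≡ 1, 5 ≡ 2 mod 3), and the level-rank examples the rows use
example : jacobiSym (-3) 7 = 1 := jacobiSym_neg_three_of_mod_three_eq_one (by decide) (by decide)

-- (5) G₃'s split clause literally excludes `2 ∥ N` (q = 2 would need 2 % 3 = 1):
example (N : ℕ) (h : ∀ q : ℕ, q.Prime → q ∣ N → ¬ q ^ 2 ∣ N → q % 3 = 1) (h2 : 2 ∣ N) : 4 ∣ N := by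
  by_contra h4
  have := h 2 Nat.prime_two h2 (by simpa using h4)
  omega

end REF1_301

/-! ### (T) discharged (typer -ty g22): `ModThreeReducibleTraceVanishing` is a THEOREM (Literature `ReducibleModThreeFrobeniusTrace.lean`), so (G₃) needs only (Gℓ) -/

/-- **(T) holds.** The parent's print-fact shape `ModThreeReducibleTraceVanishing` is, verbatim, the Literature theorem
`three_dvd_frobeniusTrace_of_not_hasIrreducibleModPGaloisRep_three_of_not_dvd_conductorNorm` (Mazur 1978 Prop. 6.3 (1) at `N = 3`: `a_ℓ ≡ r(1 + ℓ) ≡ 0 (mod 3)` for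
good `ℓ ≡ 2 (mod 3)`, `r = ±1` the isogeny character at Frobenius). -/
theorem modThreeReducibleTraceVanishing_holds : ModThreeReducibleTraceVanishing :=
  fun W _ _ hred p hp hN hp3 =>
    three_dvd_frobeniusTrace_of_not_hasIrreducibleModPGaloisRep_three_of_not_dvd_conductorNorm W hred p hp hN hp3

/-- **(Gℓ) ⟹ (G₃) unconditionally**: -es g24's glue `threeIsogenyTwist_of_oddStabiliser` with its trace-fact hypothesis (T) discharged. -/
theorem threeIsogenyTwist_of_oddStabiliser' (h : OddTwistStabiliserDividesCongruenceNumber) :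
    ThreeIsogenyTwistDividesCongruenceNumber :=
  threeIsogenyTwist_of_oddStabiliser h modThreeReducibleTraceVanishing_holds

/-! ### -es g24 addendum-5 glue (crux workfile 41d37d025705b01d, VERBATIM; typer -ty g22) -/

/-- (-es crux workfile 41d37d025705b01d, VERBATIM.) Kernel glue: the sharp form implies the filed form (whose single clause `¬ 4 ∣ N → m ≡ 1 (mod 8)` gives both sharp clauses), for
globally minimal models. -/
theorem sharp_imp_resolvent_minimal (h : ResolventTwistDividesCongruenceNumberSharp) :
    ∀ (W : WeierstrassCurve ℚ) [W.IsElliptic] [W.IsGloballyMinimal] [NeZero (W.conductorNorm ℤ)]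
    (D : ModularParametrizationData W (W.conductorNorm ℤ)) (m : ℤ), ¬ W.HasCM → Squarefree m → m ≠ 1 →
    IsSquare ((m : ℚ) * W.Δ) →
    (∀ p : ℕ, p.Prime → p ≠ 2 → (p : ℤ) ∣ m → p ^ 2 ∣ W.conductorNorm ℤ) →
    (m % 4 = 3 → 2 ^ 4 ∣ W.conductorNorm ℤ) → (2 ∣ m → 2 ^ 6 ∣ W.conductorNorm ℤ) →
    (∀ q : ℕ, q.Prime → q ≠ 2 → q ∣ W.conductorNorm ℤ → ¬ q ^ 2 ∣ W.conductorNorm ℤ → jacobiSym m q = 1) →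
    (¬ 4 ∣ W.conductorNorm ℤ → m % 8 = 1) →
    2 ^ (squareLevelTwistRank (W.conductorNorm ℤ) + 1) ∣ congruenceNumber D.f := by
  intro W _ _ _ D m hcm hsf hne hsq hp h4 h6 hsplit h8
  refine h W D m hcm hsf hne hsq hp h4 h6 hsplit ?_ ?_
  · intro h2
    exact Or.inl (h8 (fun h4N => h2 (dvd_trans (by norm_num) h4N)))
  · intro _ h4N
    exact h8 h4N

/-! ### REF1-AUDIT §311 probe block (`REF1-data/b311/block311.lean` cdcdd8201bf43488, VERBATIM minus item (5) (`native_decide` level checks — no `native_decide` in the tree port) and minus items (3)/(3′) (REF1's kernel fact `jacobiSym m 2 ≠ -1` behind rider R311a is ALREADY LANDED as `Summit.BirchSwinnertonDyer.Rank1Residual.F1Sign2.ANg25.Kernel.jacobiSym_two_ne_neg_one` in `DefiniteMod2WaldspurgerAtTwoKernel.lean` — gate `dedup.landed`; cite it, do not re-declare); typer -ty g22) -/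
section REF1_311

/-- (1) The sharp form implies the filed form — -es's own glue restated as a closed term (sanity that the clause algebra is right). -/
example (h : ResolventTwistDividesCongruenceNumberSharp) :
    ∀ (W : WeierstrassCurve ℚ) [W.IsElliptic] [W.IsGloballyMinimal] [NeZero (W.conductorNorm ℤ)]
    (D : ModularParametrizationData W (W.conductorNorm ℤ)) (m : ℤ), ¬ W.HasCM → Squarefree m → m ≠ 1 →
    IsSquare ((m : ℚ) * W.Δ) →
    (∀ p : ℕ, p.Prime → p ≠ 2 → (p : ℤ) ∣ m → p ^ 2 ∣ W.conductorNorm ℤ) →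
    (m % 4 = 3 → 2 ^ 4 ∣ W.conductorNorm ℤ) → (2 ∣ m → 2 ^ 6 ∣ W.conductorNorm ℤ) →
    (∀ q : ℕ, q.Prime → q ≠ 2 → q ∣ W.conductorNorm ℤ → ¬ q ^ 2 ∣ W.conductorNorm ℤ → jacobiSym m q = 1) →
    (¬ 4 ∣ W.conductorNorm ℤ → m % 8 = 1) →
    2 ^ (squareLevelTwistRank (W.conductorNorm ℤ) + 1) ∣ congruenceNumber D.f :=
  sharp_imp_resolvent_minimal h

/-- (2) ES-33I implies the sharp form's conclusion on its own (narrower) hypothesis set: `2^(a₀+2) ∣ r ⟹ 2^(a₀+1) ∣ r`. -/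
example (h : NonsplitCartanFourTwistDividesCongruenceNumber) :
    ∀ (W : WeierstrassCurve ℚ) [W.IsElliptic] [W.IsGloballyMinimal] [NeZero (W.conductorNorm ℤ)]
    (D : ModularParametrizationData W (W.conductorNorm ℤ)) (m : ℤ), ¬ W.HasCM → Squarefree m → m ≠ 1 →
    IsSquare ((m : ℚ) * W.Δ) →
    (∀ p : ℕ, p.Prime → p ≠ 2 → (p : ℤ) ∣ m → p ^ 2 ∣ W.conductorNorm ℤ) →
    (m % 4 = 3 → 2 ^ 4 ∣ W.conductorNorm ℤ) → (2 ∣ m → 2 ^ 6 ∣ W.conductorNorm ℤ) →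
    (∀ q : ℕ, q.Prime → q ≠ 2 → q ∣ W.conductorNorm ℤ → ¬ q ^ 2 ∣ W.conductorNorm ℤ → jacobiSym m q = 1) →
    (¬ 2 ∣ W.conductorNorm ℤ → m % 8 = 1 ∨ 2 ∣ W.frobeniusTrace 2) →
    (2 ∣ W.conductorNorm ℤ → ¬ 4 ∣ W.conductorNorm ℤ → m % 8 = 1) →
    (∀ p : ℕ, p.Prime → ¬ p ∣ W.conductorNorm ℤ → jacobiSym m p = -1 → (4 : ℤ) ∣ W.frobeniusTrace p) →
    2 ^ (squareLevelTwistRank (W.conductorNorm ℤ) + 1) ∣ congruenceNumber D.f := by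
  intro W _ _ _ D m hcm hsf hne hsq hp h4 h6 hsplit h2a h2b htr
  exact dvd_trans (pow_dvd_pow 2 (by omega)) (h W D m hcm hsf hne hsq hp h4 h6 hsplit h2a h2b htr)

/-- (4) Clause arithmetic used in the audit: Lean's `Int.emod` is non-negative, so negative resolvents are classified as on paper. -/
example : (-3 : ℤ) % 4 = 1 ∧ (-11 : ℤ) % 4 = 1 ∧ (-1 : ℤ) % 4 = 3 ∧ (-7 : ℤ) % 8 = 1 ∧ (21 : ℤ) % 8 = 5 ∧ (-35 : ℤ) % 8 = 5 ∧ (37 : ℤ) % 8 = 5 := by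
  decide

end REF1_311

/-! ### -es g25 v6 (ES-33I♯) glue (crux workfile 56e746de48b91890, VERBATIM; typer -ty g22) -/

/-- (-es crux workfile 56e746de48b91890, VERBATIM.) ES-33I implies its sharp form (the sharp form only adds a hypothesis); provers may target either. -/
theorem nonsplitCartanFourSharp_of_nonsplit (h : NonsplitCartanFourTwistDividesCongruenceNumber) :
    NonsplitCartanFourTwistDividesCongruenceNumberSharp := by
  intro W _ _ _ D m hcm hsf hne hsq hp h4 h6 hsplit h2a _h2b h8 htr
  exact h W D m hcm hsf hne hsq hp h4 h6 hsplit h2a h8 htr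

end Summit.BirchSwinnertonDyer.BirchSwinnertonDyer.Theorems.RankOneAtTwoTwistLattice.Kernel

end
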